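import Literature.MathematicalPhysics.KineticTheory.HardSphereEntranceProofs
import Literature.Analysis.FluidPDE.BoltzmannEquationProofs
import Literature.Analysis.UnboundedOperators.LinearizedBoltzmannSymmetryProofs
import HarnessLib

/-!
# K2R refutation, stub `dualitySlice` — preparation: the generic pre/post-collisional duality

Route `EnskogAdjointDuality` of `AtomisticToContinuum/HydrodynamicLimit`, crux `AdjointEnskogTestFamilyR`
(stmt-AtomisticToContinuum-11592, "K2R"), line `refutation`, stub `stub_dualitySlice` (helper file,
keyed by the sub-goal `stub_dualitySlice_prep`).

For a unit impact direction `ν ∈ S²`, the global Maxwellian `M = (2π)^{-3/2}e^{-|·|²/2}`, a velocity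
weight `Θ` and a test function `F`, the test-side hard-sphere gain pairing in which the struck thermal
particle's outgoing velocity `w' = w + ((v-w)·ν)ν = (collide ν (v,w)).2` is probed by `F` satisfies the
DUALITY (swap) formula
`∫ Θ(v) ∫ ((v-w)·ν)₊ M(w) F(w') dw dv = ∫ F(U) I[Θ](U,ν) dU`,
`I[Θ](U,ν) = (2π)⁻¹ e^{-(|U|²-a²)/2} h(a) ∫_{ℝ²} Θ(aν + ι y) dy`, `a = U·ν`, `h(a) = ∫ (a-b)₊ φ₁(b) db`,
where `(a, y) ↦ aν + ι y` are Lebesgue cylindrical coordinates adapted to `ν`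
(`exists_axisDecomposition`). Mechanism: the unit-Jacobian involution `(v, w) ↦ (w', v')`
(`integral_comp_collideSwap`) moves `F` onto the free variable; in the frame of `ν` the collision
exchanges the axial coordinates and the Maxwellian factorises (`k2r_ref_kernel_fibre`).
* `k2r_ref_integral_radial_fin_two` — `∫_{ℝ²} f(c + |y|²) dy = π ∫_c^∞ f` (keyed theorem
  `stub_dualitySlice_prep`);
* `k2r_ref_integrable_pair` — integrability of `Θ(v)((v-w)·ν)₊M(w)F(w')` on `ℝ³ × ℝ³` for
  `(1+|v|²)²Θ ∈ L¹`, `|F| ≤ C(1+|U|²)`;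
* `k2r_ref_kernel_fibre`, `k2r_ref_duality` — the kernel identity and the duality.
References: C. Cercignani, R. Illner, M. Pulvirenti, *The Mathematical Theory of Dilute Gases* (1994),
§3.1 (1.7)–(1.9) (collision change of variables) [CIP1994].
-/

noncomputable section

namespace Summit.AtomisticToContinuum.HydrodynamicLimit.Theorems.EnskogAdjointDuality

open MeasureTheory Set Filter Topology
open scoped InnerProductSpace Real
open Literature.MathematicalPhysics.KineticTheory Literature.Analysis.FluidPDE Literature.Analysis.FunctionSpaces

/-! ## Radial integration on `ℝ²` -/

/-- **Radial integration in the plane**: `∫_{ℝ²} f(c + |y|²) dy = π ∫_c^∞ f(s) ds`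
(polar coordinates, `|S¹| = 2π`, `s = c + r²`). [folklore] -/
theorem k2r_ref_integral_radial_fin_two (f : ℝ → ℝ) (c : ℝ) :
    ∫ y : EuclideanSpace ℝ (Fin 2), f (c + ‖y‖ ^ 2) = π * ∫ s in Ioi c, f s := by
  have h1 : ∫ y : EuclideanSpace ℝ (Fin 2), f (c + ‖y‖ ^ 2) =
      Module.finrank ℝ (EuclideanSpace ℝ (Fin 2)) •
        (volume : Measure (EuclideanSpace ℝ (Fin 2))).real (Metric.ball 0 1) •
          ∫ r in Ioi (0 : ℝ), r ^ (Module.finrank ℝ (EuclideanSpace ℝ (Fin 2)) - 1) • f (c + r ^ 2) :=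
    integral_fun_norm_addHaar (volume : Measure (EuclideanSpace ℝ (Fin 2))) (fun r => f (c + r ^ 2))
  have hdim : Module.finrank ℝ (EuclideanSpace ℝ (Fin 2)) = 2 := finrank_euclideanSpace_fin
  have hball : (volume : Measure (EuclideanSpace ℝ (Fin 2))).real (Metric.ball 0 1) = π := by
    simp [Measure.real, EuclideanSpace.volume_ball_fin_two, Real.pi_pos.le]
  rw [h1, hdim, hball]
  -- substitution `s = c + r²`
  have himg : (fun r : ℝ => c + r ^ 2) '' Ioi 0 = Ioi c := by
    ext s
    constructor
    · rintro ⟨r, hr, rfl⟩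
      have : (0 : ℝ) < r := hr
      change c < c + r ^ 2
      nlinarith
    · intro hs
      have hs' : c < s := hs
      refine ⟨Real.sqrt (s - c), Real.sqrt_pos.2 (by linarith), ?_⟩
      change c + Real.sqrt (s - c) ^ 2 = s
      rw [Real.sq_sqrt (by linarith)]; ring
  have hder : ∀ r ∈ Ioi (0 : ℝ), HasDerivWithinAt (fun r : ℝ => c + r ^ 2) (2 * r) (Ioi 0) r := by
    intro r _
    have h := ((hasDerivAt_pow 2 r).const_add c)
    simp only [Nat.cast_ofNat, Nat.add_one_sub_one, pow_one] at h
    exact h.hasDerivWithinAt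
  have hinj : InjOn (fun r : ℝ => c + r ^ 2) (Ioi 0) := by
    intro r hr r' hr' h
    have h2 : r ^ 2 = r' ^ 2 := by simpa using h
    have hr0 : (0 : ℝ) < r := hr
    have hr0' : (0 : ℝ) < r' := hr'
    nlinarith
  have hsub := integral_image_eq_integral_abs_deriv_smul measurableSet_Ioi hder hinj f
  rw [himg] at hsub
  rw [hsub]
  have h3 : ∫ r in Ioi (0 : ℝ), |2 * r| • f (c + r ^ 2) =
      2 * ∫ r in Ioi (0 : ℝ), r ^ (2 - 1) • f (c + r ^ 2) := by
    rw [← integral_const_mul]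
    refine setIntegral_congr_fun measurableSet_Ioi (fun r hr => ?_)
    have hr0 : (0 : ℝ) < r := hr
    simp only [smul_eq_mul, abs_of_pos (by positivity : (0 : ℝ) < 2 * r)]
    ring
  rw [h3]
  simp only [nsmul_eq_mul, smul_eq_mul, Nat.cast_ofNat]
  ring


/-! ## Fibre coordinates adapted to the impact direction -/

section Fibre

variable {e : EuclideanSpace ℝ (Fin 3)} (he : ‖e‖ = 1) (ι : EuclideanSpace ℝ (Fin 2) →ₗᵢ[ℝ] EuclideanSpace ℝ (Fin 3)) (hιe : ∀ u, ⟪e, ι u⟫_ℝ = 0)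
include he hιe

/-- Axial component in adapted coordinates: `⟪a e + ι y, e⟫ = a`. [folklore] -/
theorem k2r_ref_inner_axis (a : ℝ) (y : EuclideanSpace ℝ (Fin 2)) : ⟪a • e + ι y, e⟫_ℝ = a := by
  rw [real_inner_comm]
  exact (norm_axis_add he ι hιe a y).2

/-- Pythagoras in adapted coordinates: `‖a e + ι y‖² = a² + ‖y‖²`. [folklore] -/
theorem k2r_ref_norm_sq_axis (a : ℝ) (y : EuclideanSpace ℝ (Fin 2)) : ‖a • e + ι y‖ ^ 2 = a ^ 2 + ‖y‖ ^ 2 := by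
  rw [(norm_axis_add he ι hιe a y).1, Real.sq_sqrt (by positivity)]

/-- The relative axial velocity in adapted coordinates: `⟪U - (b e + ι y), e⟫ = ⟪U, e⟫ - b`. [folklore] -/
theorem k2r_ref_inner_sub_axis (U : EuclideanSpace ℝ (Fin 3)) (b : ℝ) (y : EuclideanSpace ℝ (Fin 2)) :
    ⟪U - (b • e + ι y), e⟫_ℝ = ⟪U, e⟫_ℝ - b := by
  rw [inner_sub_left, k2r_ref_inner_axis he ι hιe]

omit hιe in
/-- `‖U - c e‖² = ‖U‖² - 2c⟪U, e⟫ + c²` for a unit vector `e`. [folklore] -/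
theorem k2r_ref_norm_sq_sub_smul (U : EuclideanSpace ℝ (Fin 3)) (c : ℝ) :
    ‖U - c • e‖ ^ 2 = ‖U‖ ^ 2 - 2 * c * ⟪U, e⟫_ℝ + c ^ 2 := by
  rw [norm_sub_sq_real, real_inner_smul_right, norm_smul, he, mul_one, Real.norm_eq_abs, sq_abs]
  ring

end Fibre

/-- The global Maxwellian on `ℝ³`: `M(x) = (2π)^{-3/2} e^{-|x|²/2}`. [folklore] -/
theorem k2r_ref_globalMaxwellian_eq (x : EuclideanSpace ℝ (Fin 3)) :
    globalMaxwellian x = (2 * π) ^ (-(3 : ℝ) / 2) * Real.exp (-‖x‖ ^ 2 / 2) := by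
  rw [globalMaxwellian, finrank_euclideanSpace_fin]
  norm_num

/-- `(2π)^{-3/2} √(2π) = (2π)⁻¹`. [folklore] -/
theorem k2r_ref_rpow_aux : (2 * π) ^ (-(3 : ℝ) / 2) * Real.sqrt (2 * π) = (2 * π)⁻¹ := by
  have h2π : 0 < 2 * π := by positivity
  rw [Real.sqrt_eq_rpow, ← Real.rpow_add h2π, ← Real.rpow_neg_one]
  norm_num

/-! ## The generic duality per impact direction -/

/-- **Integrability of the weighted gain integrand on `ℝ³ × ℝ³`.** For a measurable weight `Θ`
with `(1+|v|²)² Θ ∈ L¹` and a measurable `F` of quadratic growth,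
`(v, w) ↦ Θ(v) ((v-w)·ν)₊ M(w) F(w')` is integrable (`|w'|² ≤ |v|² + |w|²`, domination by
`C (1+|v|²)²|Θ(v)| · (1+|w|)³ M(w)`). [folklore] -/
theorem k2r_ref_integrable_pair (ν : Metric.sphere (0 : EuclideanSpace ℝ (Fin 3)) 1) {Θ : EuclideanSpace ℝ (Fin 3) → ℝ} (hΘm : Measurable Θ)
    (hΘi : Integrable fun v => (1 + ‖v‖ ^ 2) ^ 2 * Θ v) {F : EuclideanSpace ℝ (Fin 3) → ℝ} (hF : Measurable F)
    {CF : ℝ} (hCF : ∀ U, |F U| ≤ CF * (1 + ‖U‖ ^ 2)) :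
    Integrable (fun p : EuclideanSpace ℝ (Fin 3) × EuclideanSpace ℝ (Fin 3) =>
      Θ p.1 * (max ⟪p.1 - p.2, (ν : EuclideanSpace ℝ (Fin 3))⟫_ℝ 0 * globalMaxwellian p.2 * F (collide ν p).2)) := by
  have hCF0 : 0 ≤ CF := by
    have h := hCF 0
    rw [norm_zero] at h
    have : |F 0| ≤ CF := by simpa using h
    exact (abs_nonneg _).trans this
  have hν : ‖(ν : EuclideanSpace ℝ (Fin 3))‖ = 1 := norm_eq_of_mem_sphere ν
  have hW : Integrable (fun w : EuclideanSpace ℝ (Fin 3) => (1 + ‖w‖) ^ 3 * globalMaxwellian w) :=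
    Literature.Analysis.UnboundedOperators.integrable_one_add_norm_pow_mul_globalMaxwellian 3
  have hdom : Integrable (fun p : EuclideanSpace ℝ (Fin 3) × EuclideanSpace ℝ (Fin 3) =>
      CF * (|(1 + ‖p.1‖ ^ 2) ^ 2 * Θ p.1| * ((1 + ‖p.2‖) ^ 3 * globalMaxwellian p.2))) :=
    (hΘi.abs.mul_prod hW).const_mul CF
  have hMm : Measurable (globalMaxwellian : EuclideanSpace ℝ (Fin 3) → ℝ) := continuous_globalMaxwellian.measurable
  have hcm : Measurable (fun p : EuclideanSpace ℝ (Fin 3) × EuclideanSpace ℝ (Fin 3) => F (collide ν p).2) :=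
    hF.comp (continuous_collide ν).snd.measurable
  refine hdom.mono' ?_ (Eventually.of_forall fun p => ?_)
  · refine Measurable.aestronglyMeasurable ?_
    fun_prop
  · obtain ⟨v, w⟩ := p
    rw [Real.norm_eq_abs]
    simp only
    have hM : 0 < globalMaxwellian w := globalMaxwellian_pos w
    have hB : max ⟪v - w, (ν : EuclideanSpace ℝ (Fin 3))⟫_ℝ 0 ≤ (1 + ‖v‖ ^ 2) * (1 + ‖w‖) := by
      refine max_le ?_ (by positivity)
      calc ⟪v - w, (ν : EuclideanSpace ℝ (Fin 3))⟫_ℝ ≤ |⟪v - w, (ν : EuclideanSpace ℝ (Fin 3))⟫_ℝ| := le_abs_self _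
        _ ≤ ‖v - w‖ * ‖(ν : EuclideanSpace ℝ (Fin 3))‖ := abs_real_inner_le_norm _ _
        _ ≤ (‖v‖ + ‖w‖) * 1 := by rw [hν]; gcongr; exact norm_sub_le v w
        _ ≤ (1 + ‖v‖ ^ 2) * (1 + ‖w‖) := by
            nlinarith [sq_nonneg (‖v‖ - 1), norm_nonneg v, norm_nonneg w,
              mul_nonneg (sq_nonneg ‖v‖) (norm_nonneg w)]
    have hF' : |F (collide ν (v, w)).2| ≤ CF * ((1 + ‖v‖ ^ 2) * (1 + ‖w‖) ^ 2) := by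
      refine (hCF _).trans (mul_le_mul_of_nonneg_left ?_ hCF0)
      have h := norm_sq_collide_fst_add_norm_sq_collide_snd ν (v, w)
      simp only at h
      nlinarith [sq_nonneg ‖(collide ν (v, w)).1‖, norm_nonneg w, norm_nonneg v,
        mul_nonneg (sq_nonneg ‖v‖) (norm_nonneg w), mul_nonneg (sq_nonneg ‖v‖) (sq_nonneg ‖w‖)]
    calc |Θ v * (max ⟪v - w, (ν : EuclideanSpace ℝ (Fin 3))⟫_ℝ 0 * globalMaxwellian w * F (collide ν (v, w)).2)|
        = |Θ v| * (max ⟪v - w, (ν : EuclideanSpace ℝ (Fin 3))⟫_ℝ 0 * globalMaxwellian w * |F (collide ν (v, w)).2|) := by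
          rw [abs_mul, abs_mul, abs_mul, abs_of_nonneg (le_max_right ⟪v - w, (ν : EuclideanSpace ℝ (Fin 3))⟫_ℝ 0),
            abs_of_pos hM]
      _ ≤ |Θ v| * ((1 + ‖v‖ ^ 2) * (1 + ‖w‖) * globalMaxwellian w *
            (CF * ((1 + ‖v‖ ^ 2) * (1 + ‖w‖) ^ 2))) := by gcongr
      _ = CF * (|(1 + ‖v‖ ^ 2) ^ 2 * Θ v| * ((1 + ‖w‖) ^ 3 * globalMaxwellian w)) := by
          rw [abs_mul, abs_of_nonneg (by positivity : (0 : ℝ) ≤ (1 + ‖v‖ ^ 2) ^ 2)]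
          ring

/-- **The dual gain kernel in the frame of the impact direction.** For a unit vector `e`, adapted
coordinates `(a, u) ↦ a e + ι u` and a measurable weight `Θ`:
`∫ ((U-W)·e)₊ M(U - ((U-W)·e) e) Θ(W + ((U-W)·e) e) dW = (2π)⁻¹ e^{-(|U|²-a²)/2} h(a) ∫_{ℝ²} Θ(a e + ι y) dy`,
`a = U·e`, `h(a) = ∫ (a-b)₊ φ₁(b) db` (write `W = b e + ι y`: the collision exchanges the axial
coordinates and the Maxwellian factorises). [folklore] -/
theorem k2r_ref_kernel_fibre {e : EuclideanSpace ℝ (Fin 3)} (he : ‖e‖ = 1) (ι : EuclideanSpace ℝ (Fin 2) →ₗᵢ[ℝ] EuclideanSpace ℝ (Fin 3)) (hιe : ∀ u, ⟪e, ι u⟫_ℝ = 0)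
    (hΦ : MeasurePreserving (fun p : ℝ × EuclideanSpace ℝ (Fin 2) => p.1 • e + ι p.2) (volume.prod volume) volume)
    {Θ : EuclideanSpace ℝ (Fin 3) → ℝ} (hΘm : Measurable Θ) (U : EuclideanSpace ℝ (Fin 3)) :
    ∫ W, max ⟪U - W, e⟫_ℝ 0 * globalMaxwellian (U - ⟪U - W, e⟫_ℝ • e) * Θ (W + ⟪U - W, e⟫_ℝ • e) =
      (2 * π)⁻¹ * Real.exp (-(‖U‖ ^ 2 - ⟪U, e⟫_ℝ ^ 2) / 2) *
        (∫ b, max (⟪U, e⟫_ℝ - b) 0 * (Real.exp (-b ^ 2 / 2) / Real.sqrt (2 * π))) *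
        ∫ y, Θ (⟪U, e⟫_ℝ • e + ι y) := by
  set a : ℝ := ⟪U, e⟫_ℝ with ha
  set g : EuclideanSpace ℝ (Fin 3) → ℝ := fun W =>
    max ⟪U - W, e⟫_ℝ 0 * globalMaxwellian (U - ⟪U - W, e⟫_ℝ • e) * Θ (W + ⟪U - W, e⟫_ℝ • e) with hg
  have hMm : Measurable (globalMaxwellian : EuclideanSpace ℝ (Fin 3) → ℝ) := continuous_globalMaxwellian.measurable
  have hgm : Measurable g := by
    simp only [hg]
    fun_prop
  -- pull back along the adapted coordinates
  have h1 : ∫ W, g W = ∫ q : ℝ × EuclideanSpace ℝ (Fin 2), g (q.1 • e + ι q.2) ∂(volume.prod volume) := by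
    have hg' : AEStronglyMeasurable g
        (Measure.map (fun p : ℝ × EuclideanSpace ℝ (Fin 2) => p.1 • e + ι p.2) (volume.prod volume)) := by
      rw [hΦ.map_eq]; exact hgm.aestronglyMeasurable
    have h := integral_map hΦ.measurable.aemeasurable hg'
    rw [hΦ.map_eq] at h
    exact h
  -- the integrand factorises on the fibre
  set C : ℝ := (2 * π) ^ (-(3 : ℝ) / 2) * Real.exp (-(‖U‖ ^ 2 - a ^ 2) / 2) * Real.sqrt (2 * π)
    with hC
  have hsq : Real.sqrt (2 * π) ≠ 0 := (Real.sqrt_pos.2 (by positivity)).ne'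
  have h2 : ∀ (b : ℝ) (y : EuclideanSpace ℝ (Fin 2)), g (b • e + ι y) =
      C * (max (a - b) 0 * (Real.exp (-b ^ 2 / 2) / Real.sqrt (2 * π))) * Θ (a • e + ι y) := by
    intro b y
    have hin : ⟪U - (b • e + ι y), e⟫_ℝ = a - b := k2r_ref_inner_sub_axis he ι hιe U b y
    have hpost : b • e + ι y + (a - b) • e = a • e + ι y := by rw [sub_smul]; abel
    have hnorm : ‖U - (a - b) • e‖ ^ 2 = ‖U‖ ^ 2 - a ^ 2 + b ^ 2 := by
      rw [k2r_ref_norm_sq_sub_smul he, ← ha]; ring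
    have hexp : Real.exp (-(‖U‖ ^ 2 - a ^ 2 + b ^ 2) / 2) =
        Real.exp (-(‖U‖ ^ 2 - a ^ 2) / 2) * Real.exp (-b ^ 2 / 2) := by
      rw [← Real.exp_add]; congr 1; ring
    simp only [hg, hin, hpost, k2r_ref_globalMaxwellian_eq, hnorm, hexp, hC]
    field_simp
  rw [h1]
  have h3 : ∫ q : ℝ × EuclideanSpace ℝ (Fin 2), g (q.1 • e + ι q.2) ∂(volume.prod volume) =
      (∫ b, C * (max (a - b) 0 * (Real.exp (-b ^ 2 / 2) / Real.sqrt (2 * π)))) *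
        ∫ y, Θ (a • e + ι y) := by
    simp_rw [h2]
    exact integral_prod_mul (μ := volume) (ν := volume)
      (fun b : ℝ => C * (max (a - b) 0 * (Real.exp (-b ^ 2 / 2) / Real.sqrt (2 * π))))
      (fun y : EuclideanSpace ℝ (Fin 2) => Θ (a • e + ι y))
  rw [h3, integral_const_mul, hC, mul_assoc ((2 * π) ^ (-(3 : ℝ) / 2)), mul_comm (Real.exp _),
    ← mul_assoc, k2r_ref_rpow_aux]

/-- **Pre/post-collisional duality per impact direction (generic weight).** For a unit impact
direction `ν` with adapted coordinates `ι`, a measurable weight `Θ` with `(1+|v|²)²Θ ∈ L¹`, a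
measurable `F` of quadratic growth and any kernel `I` with
`I(U) = (2π)⁻¹ e^{-(|U|²-a²)/2} h(a) ∫_{ℝ²} Θ(a ν + ι y) dy`, `a = U·ν`:
`∫ Θ(v) ∫ ((v-w)·ν)₊ M(w) F(w') dw dv = ∫ F(U) I(U) dU` and `F I ∈ L¹`
(the measure-preserving involution `(v, w) ↦ (w', v')` followed by the fibre computation
`k2r_ref_kernel_fibre`). [cite: CIP1994, §3.1 (1.7)–(1.9)] -/
theorem k2r_ref_duality (ν : Metric.sphere (0 : EuclideanSpace ℝ (Fin 3)) 1) (ι : EuclideanSpace ℝ (Fin 2) →ₗᵢ[ℝ] EuclideanSpace ℝ (Fin 3))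
    (hιe : ∀ u, ⟪(ν : EuclideanSpace ℝ (Fin 3)), ι u⟫_ℝ = 0)
    (hΦ : MeasurePreserving (fun p : ℝ × EuclideanSpace ℝ (Fin 2) => p.1 • (ν : EuclideanSpace ℝ (Fin 3)) + ι p.2) (volume.prod volume) volume)
    {Θ : EuclideanSpace ℝ (Fin 3) → ℝ} (hΘm : Measurable Θ) (hΘi : Integrable fun v => (1 + ‖v‖ ^ 2) ^ 2 * Θ v)
    {F : EuclideanSpace ℝ (Fin 3) → ℝ} (hF : Measurable F) {CF : ℝ} (hCF : ∀ U, |F U| ≤ CF * (1 + ‖U‖ ^ 2))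
    {I : EuclideanSpace ℝ (Fin 3) → ℝ}
    (hI : ∀ U : EuclideanSpace ℝ (Fin 3), (2 * π)⁻¹ * Real.exp (-(‖U‖ ^ 2 - ⟪U, (ν : EuclideanSpace ℝ (Fin 3))⟫_ℝ ^ 2) / 2) *
        (∫ b, max (⟪U, (ν : EuclideanSpace ℝ (Fin 3))⟫_ℝ - b) 0 * (Real.exp (-b ^ 2 / 2) / Real.sqrt (2 * π))) *
        ∫ y, Θ (⟪U, (ν : EuclideanSpace ℝ (Fin 3))⟫_ℝ • (ν : EuclideanSpace ℝ (Fin 3)) + ι y) = I U) :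
    Integrable (fun U : EuclideanSpace ℝ (Fin 3) => F U * I U) ∧
    ∫ v, Θ v * ∫ w, max ⟪v - w, (ν : EuclideanSpace ℝ (Fin 3))⟫_ℝ 0 * globalMaxwellian w * F (collide ν (v, w)).2 =
      ∫ U, F U * I U := by
  have he : ‖(ν : EuclideanSpace ℝ (Fin 3))‖ = 1 := norm_eq_of_mem_sphere ν
  set H : EuclideanSpace ℝ (Fin 3) × EuclideanSpace ℝ (Fin 3) → ℝ := fun p =>
    Θ p.1 * (max ⟪p.1 - p.2, (ν : EuclideanSpace ℝ (Fin 3))⟫_ℝ 0 * globalMaxwellian p.2 * F (collide ν p).2) with hH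
  have hHi : Integrable H ((volume : Measure (EuclideanSpace ℝ (Fin 3))).prod volume) :=
    k2r_ref_integrable_pair ν hΘm hΘi hF hCF
  -- the integrand after the involution `(v, w) ↦ (w', v')`
  have hswap : ∀ p : EuclideanSpace ℝ (Fin 3) × EuclideanSpace ℝ (Fin 3), H (collide ν p).swap =
      F p.1 * (max ⟪p.1 - p.2, (ν : EuclideanSpace ℝ (Fin 3))⟫_ℝ 0 *
        globalMaxwellian (p.1 - ⟪p.1 - p.2, (ν : EuclideanSpace ℝ (Fin 3))⟫_ℝ • (ν : EuclideanSpace ℝ (Fin 3))) *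
        Θ (p.2 + ⟪p.1 - p.2, (ν : EuclideanSpace ℝ (Fin 3))⟫_ℝ • (ν : EuclideanSpace ℝ (Fin 3)))) := by
    intro p
    have h1 : collide ν (collide ν p).swap = p.swap := by rw [collide_swap, collide_collide]
    have hq0 : ∀ q : ℝ, ⟪p.2 + q • (ν : EuclideanSpace ℝ (Fin 3)) - (p.1 - q • (ν : EuclideanSpace ℝ (Fin 3))), (ν : EuclideanSpace ℝ (Fin 3))⟫_ℝ =
        2 * q - ⟪p.1 - p.2, (ν : EuclideanSpace ℝ (Fin 3))⟫_ℝ := by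
      intro q
      rw [inner_sub_left, inner_add_left, inner_sub_left p.1, real_inner_smul_left,
        real_inner_self_eq_norm_sq, he, inner_sub_left p.1 p.2]
      ring
    have hq : ⟪p.2 + ⟪p.1 - p.2, (ν : EuclideanSpace ℝ (Fin 3))⟫_ℝ • (ν : EuclideanSpace ℝ (Fin 3)) - (p.1 - ⟪p.1 - p.2, (ν : EuclideanSpace ℝ (Fin 3))⟫_ℝ • (ν : EuclideanSpace ℝ (Fin 3))),
        (ν : EuclideanSpace ℝ (Fin 3))⟫_ℝ = ⟪p.1 - p.2, (ν : EuclideanSpace ℝ (Fin 3))⟫_ℝ := by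
      rw [hq0]; ring
    simp only [hH, Prod.fst_swap, Prod.snd_swap, h1]
    simp only [collide, hq]
    ring
  have hHΨi : Integrable (fun p : EuclideanSpace ℝ (Fin 3) × EuclideanSpace ℝ (Fin 3) => H (collide ν p).swap) ((volume : Measure (EuclideanSpace ℝ (Fin 3))).prod volume) :=
    (measurePreserving_collideSwap ν).integrable_comp_of_integrable hHi
  have hinner : ∀ U, ∫ W, H (collide ν (U, W)).swap = F U * I U := by
    intro U
    simp_rw [hswap]
    rw [integral_const_mul, k2r_ref_kernel_fibre he ι hιe hΦ hΘm U, hI U]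
  refine ⟨hHΨi.integral_prod_left.congr (Eventually.of_forall hinner), ?_⟩
  calc ∫ v, Θ v * ∫ w, max ⟪v - w, (ν : EuclideanSpace ℝ (Fin 3))⟫_ℝ 0 * globalMaxwellian w * F (collide ν (v, w)).2
      = ∫ v, ∫ w, H (v, w) := by
        refine integral_congr_ae (Eventually.of_forall fun v => ?_)
        simp only [hH, ← integral_const_mul]
    _ = ∫ p, H p ∂((volume : Measure (EuclideanSpace ℝ (Fin 3))).prod volume) := (integral_prod H hHi).symm
    _ = ∫ p, H (collide ν p).swap ∂((volume : Measure (EuclideanSpace ℝ (Fin 3))).prod volume) :=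
        (integral_comp_collideSwap ν H).symm
    _ = ∫ U, ∫ W, H (collide ν (U, W)).swap := integral_prod _ hHΨi
    _ = ∫ U, F U * I U := integral_congr_ae (Eventually.of_forall hinner)

/-- Keyed sub-goal of this preparation file (registered stub `stub_dualitySlice_prep`): radial
integration in the plane, `∫_{ℝ²} f(c + |y|²) dy = π ∫_c^∞ f(s) ds`. [folklore] -/
theorem stub_dualitySlice_prep : ∀ (f : ℝ → ℝ) (c : ℝ),
    ∫ y : EuclideanSpace ℝ (Fin 2), f (c + ‖y‖ ^ 2) = Real.pi * ∫ s in Set.Ioi c, f s :=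
  k2r_ref_integral_radial_fin_two

end Summit.AtomisticToContinuum.HydrodynamicLimit.Theorems.EnskogAdjointDuality
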